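import Mathlib
import Literature.MathematicalPhysics.MHD.SolovevFluxSurfaceLoop
import Literature.MathematicalPhysics.MHD.FluxSurfaceGeometry
import HarnessLib

/-!
# Field data along the printed Lee–Cerfon flux-surface loop and Mercier's functional `I(U)` (12.84) on it
# as an explicit one-dimensional integral (proved)

Third file of the `lcLoop` series (`SolovevFluxSurfaceLoop.lean`: Freidberg's `q` (6.35) on the loop;
`SolovevFluxSurfaceLoopTrace.lean`: the loop traces its surface once). For the Lee–Cerfon/CHEASE Solov'ev
solution `Ψ = psiLC κ F_B R₀ q₀ a` [Lee–Cerfon 2015 §4.1 (solo2), bib `LeeCerfon2015`] and its PRINTED surface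
parametrisation `lcLoop R₀ κ r` (`R² = u = R₀² + 2rR₀cos t`, `Z = κ r R₀ sin t/R`), with `c = κF_B/(2R₀³q₀)`:

* `dZ_psiLC_lcLoop`, `dR_psiLC_lcLoop` — `Ψ_Z = 2crR₀√u sin t/κ`, `Ψ_R = 2crR₀(u cos t + rR₀sin²t)/√u` on the loop;
* `gradSq_psiLC_lcLoop` — `|∇Ψ|² = lcGradSq = (2crR₀)²(u sin²t/κ² + (u cos t + rR₀sin²t)²/u)`, and
  `lcGradSq_pos` — it is positive (`∇Ψ ≠ 0` on every regular surface `0 < r < R₀/2`);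
* `deriv_lcLoop_fst/snd` — the loop velocity is `(R′, Z′) = (κ/(2cu))·(−Ψ_Z, Ψ_R)`; hence
  `speed_lcLoop`: `|γ′| = (κ/(2cu))|∇Ψ|`, and `fieldBpol_lcLoop`: `B_p = |∇Ψ|/√u` (Freidberg (12.32));
* **`mercierIE_lcLoop`** — Mercier's functional AS PRINTED, `I(U) = (1/2π)∮ U dl/(R²B_p³)` (Freidberg 2014
  §12.5.3 eq. (12.84), Euclidean arc length, `FluxGeometry.mercierIE`), on the printed loop equals the
  one-dimensional integral `(1/2π)∫₀^{2π} U(γ(t))·w(t) dt` with the explicit ALGEBRAIC weight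
  `w = lcMercierWeight = κ√u/(2cu·|∇Ψ|²)`, for ANY integrand `U` and every surface — so each of the five
  `I(U)`, `U ∈ {1, B², RB_pκ_n, Γ, Γ/B²}`, of Mercier's `D_M` is a certified-quadrature target once `U` along
  the loop is explicit (`1`: `mercierIE_lcLoop_one`; `B² = (F_B² + lcGradSq)/u` by `FluxGeometry.fieldBsq_const`;
  `RB_pκ_n` by `Solovev.normalCurvature_psiPCF` for the PCF member; `Γ` needs the local shear `∂Q/∂ψ`,
  not typed yet — pub/gridfusion/models/F2-SCOPING.md R3).

HONEST FRAMING: exact real analysis about MODEL objects (ideal MHD, Solov'ev profiles, analytic fixed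
boundary); an enclosure of any `I(U)` is a Bench matter (two quadrature lineages); nothing here says anything
is stable. Typer/prover: gridfusion-model-5 (g2), 2026-08-27.
-/

noncomputable section

namespace Literature.MathematicalPhysics.MHD.Solovev

open GradShafranov FluxGeometry _root_.Real MeasureTheory intervalIntegral

/-! ## Explicit field data along `lcLoop R₀ κ r` -/

/-- `|∇Ψ|²` along the printed loop, explicit in `t`: with `c = κF_B/(2R₀³q₀)`, `u = R₀² + 2rR₀cos t`,
`|∇Ψ|²(γ(t)) = (2crR₀)²·(u sin²t/κ² + (u cos t + rR₀ sin²t)²/u)`. [cite: LeeCerfon2015, §4.1 (boundary parametrisation)] -/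
def lcGradSq (κ FB R₀ q₀ r t : ℝ) : ℝ :=
  (2 * (κ * FB / (2 * R₀ ^ 3 * q₀)) * r * R₀) ^ 2
    * (lcU R₀ r t * Real.sin t ^ 2 / κ ^ 2
      + (lcU R₀ r t * Real.cos t + r * R₀ * Real.sin t ^ 2) ^ 2 / lcU R₀ r t)

/-- The Mercier weight along the printed loop: `w(t) = κ√u/(2cu·|∇Ψ|²)` — the density of `dl/(R²B_p³)`
with respect to `dt` (`dl = (κ/(2cu))|∇Ψ| dt`, `B_p = |∇Ψ|/R`, `R = √u`). [cite: LeeCerfon2015, §4.1 (boundary parametrisation)] -/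
def lcMercierWeight (κ FB R₀ q₀ r t : ℝ) : ℝ :=
  κ * Real.sqrt (lcU R₀ r t) / (2 * (κ * FB / (2 * R₀ ^ 3 * q₀)) * lcU R₀ r t * lcGradSq κ FB R₀ q₀ r t)

/-- `Ψ_Z` along the loop: `2crR₀ √u sin t/κ`. [cite: LeeCerfon2015, §4.1 eq. (solo2)] -/
theorem dZ_psiLC_lcLoop {R₀ κ r : ℝ} (hR₀ : 0 < R₀) (hκ : κ ≠ 0) (hr : 0 ≤ r) (h2r : 2 * r < R₀)
    (FB q₀ a t : ℝ) :
    dZ (psiLC κ FB R₀ q₀ a) (lcLoop R₀ κ r t).1 (lcLoop R₀ κ r t).2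
      = 2 * (κ * FB / (2 * R₀ ^ 3 * q₀)) * r * R₀ * Real.sqrt (lcU R₀ r t) * Real.sin t / κ := by
  have hu := lcU_pos hR₀ hr h2r t
  set s := Real.sqrt (lcU R₀ r t) with hs_def
  have hs : 0 < s := Real.sqrt_pos.2 hu
  simp only [lcLoop, dZ_psiLC]
  rw [← hs_def]
  field_simp

/-- `Ψ_R` along the loop: `2crR₀ (u cos t + rR₀ sin²t)/√u`. [cite: LeeCerfon2015, §4.1 eq. (solo2)] -/
theorem dR_psiLC_lcLoop {R₀ κ r : ℝ} (hR₀ : 0 < R₀) (hκ : κ ≠ 0) (hr : 0 ≤ r) (h2r : 2 * r < R₀)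
    (FB q₀ a t : ℝ) :
    dR (psiLC κ FB R₀ q₀ a) (lcLoop R₀ κ r t).1 (lcLoop R₀ κ r t).2
      = 2 * (κ * FB / (2 * R₀ ^ 3 * q₀)) * r * R₀
          * (lcU R₀ r t * Real.cos t + r * R₀ * Real.sin t ^ 2) / Real.sqrt (lcU R₀ r t) := by
  have hu := lcU_pos hR₀ hr h2r t
  set s := Real.sqrt (lcU R₀ r t) with hs_def
  have hs : 0 < s := Real.sqrt_pos.2 hu
  have hu' : lcU R₀ r t = s ^ 2 := by rw [hs_def, Real.sq_sqrt hu.le]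
  have e : s ^ 2 - R₀ ^ 2 = 2 * r * R₀ * Real.cos t := by rw [← hu']; unfold lcU; ring
  simp only [lcLoop]
  rw [← hs_def, dR_psiLC, hu', e]
  field_simp

/-- `|∇Ψ|²` along the loop equals `lcGradSq`. [cite: LeeCerfon2015, §4.1 (boundary parametrisation)] -/
theorem gradSq_psiLC_lcLoop {R₀ κ r : ℝ} (hR₀ : 0 < R₀) (hκ : κ ≠ 0) (hr : 0 ≤ r) (h2r : 2 * r < R₀)
    (FB q₀ a t : ℝ) :
    gradSq (psiLC κ FB R₀ q₀ a) (lcLoop R₀ κ r t).1 (lcLoop R₀ κ r t).2 = lcGradSq κ FB R₀ q₀ r t := by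
  have hu := lcU_pos hR₀ hr h2r t
  have hdR := dR_psiLC_lcLoop hR₀ hκ hr h2r FB q₀ a t
  have hdZ := dZ_psiLC_lcLoop hR₀ hκ hr h2r FB q₀ a t
  set s := Real.sqrt (lcU R₀ r t) with hs_def
  have hs : 0 < s := Real.sqrt_pos.2 hu
  have hu' : lcU R₀ r t = s ^ 2 := by rw [hs_def, Real.sq_sqrt hu.le]
  unfold gradSq lcGradSq
  rw [hdR, hdZ, hu']
  field_simp
  ring

/-- `|∇Ψ|² > 0` along the loop (`∇Ψ ≠ 0` on a regular flux surface; `r > 0`, `c ≠ 0`).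
[cite: LeeCerfon2015, §4.1 (boundary parametrisation)] -/
theorem lcGradSq_pos {R₀ κ FB q₀ r : ℝ} (hR₀ : 0 < R₀) (hκ : 0 < κ) (hFB : 0 < FB) (hq₀ : 0 < q₀)
    (hr : 0 < r) (h2r : 2 * r < R₀) (t : ℝ) : 0 < lcGradSq κ FB R₀ q₀ r t := by
  have hu := lcU_pos hR₀ hr.le h2r t
  have hsc := Real.sin_sq_add_cos_sq t
  unfold lcGradSq
  have hc : 0 < 2 * (κ * FB / (2 * R₀ ^ 3 * q₀)) * r * R₀ := by positivity
  apply mul_pos (pow_pos hc 2)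
  by_cases hsin : Real.sin t = 0
  · have hcos2 : Real.cos t ^ 2 = 1 := by nlinarith
    have h2 : 0 < (lcU R₀ r t * Real.cos t + r * R₀ * Real.sin t ^ 2) ^ 2 / lcU R₀ r t := by
      apply div_pos _ hu
      rw [hsin]
      have : (lcU R₀ r t * Real.cos t + r * R₀ * (0 : ℝ) ^ 2) ^ 2 = lcU R₀ r t ^ 2 := by
        nlinarith [hcos2]
      rw [this]; positivity
    have h1 : 0 ≤ lcU R₀ r t * Real.sin t ^ 2 / κ ^ 2 := by positivity
    linarith
  · have h1 : 0 < lcU R₀ r t * Real.sin t ^ 2 / κ ^ 2 := by positivity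
    have h2 : 0 ≤ (lcU R₀ r t * Real.cos t + r * R₀ * Real.sin t ^ 2) ^ 2 / lcU R₀ r t := by positivity
    linarith

/-- The loop velocity is `(R′, Z′) = (κ/(2cu))·(−Ψ_Z, Ψ_R)`: first component.
[cite: LeeCerfon2015, §4.1 (boundary parametrisation)] -/
theorem deriv_lcLoop_fst {R₀ κ FB q₀ r : ℝ} (hR₀ : 0 < R₀) (hκ : 0 < κ) (hFB : 0 < FB) (hq₀ : 0 < q₀)
    (hr : 0 ≤ r) (h2r : 2 * r < R₀) (a t : ℝ) :
    deriv (fun s => (lcLoop R₀ κ r s).1) t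
      = -(κ / (2 * (κ * FB / (2 * R₀ ^ 3 * q₀)) * lcU R₀ r t)
          * dZ (psiLC κ FB R₀ q₀ a) (lcLoop R₀ κ r t).1 (lcLoop R₀ κ r t).2) := by
  have hu := lcU_pos hR₀ hr h2r t
  have hd := (hasDerivAt_lcLoop_fst hR₀ hr h2r κ t).deriv
  have hdZ := dZ_psiLC_lcLoop hR₀ hκ.ne' hr h2r FB q₀ a t
  set s := Real.sqrt (lcU R₀ r t) with hs_def
  have hs : 0 < s := Real.sqrt_pos.2 hu
  have hu' : lcU R₀ r t = s ^ 2 := by rw [hs_def, Real.sq_sqrt hu.le]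
  rw [hd, hdZ, hu']
  field_simp

/-- The loop velocity is `(R′, Z′) = (κ/(2cu))·(−Ψ_Z, Ψ_R)`: second component.
[cite: LeeCerfon2015, §4.1 (boundary parametrisation)] -/
theorem deriv_lcLoop_snd {R₀ κ FB q₀ r : ℝ} (hR₀ : 0 < R₀) (hκ : 0 < κ) (hFB : 0 < FB) (hq₀ : 0 < q₀)
    (hr : 0 ≤ r) (h2r : 2 * r < R₀) (a t : ℝ) :
    deriv (fun s => (lcLoop R₀ κ r s).2) t
      = κ / (2 * (κ * FB / (2 * R₀ ^ 3 * q₀)) * lcU R₀ r t)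
          * dR (psiLC κ FB R₀ q₀ a) (lcLoop R₀ κ r t).1 (lcLoop R₀ κ r t).2 := by
  have hu := lcU_pos hR₀ hr h2r t
  have hd := (hasDerivAt_lcLoop_snd hR₀ hr h2r κ t).deriv
  have hdR := dR_psiLC_lcLoop hR₀ hκ.ne' hr h2r FB q₀ a t
  set s := Real.sqrt (lcU R₀ r t) with hs_def
  have hs : 0 < s := Real.sqrt_pos.2 hu
  have hu' : lcU R₀ r t = s ^ 2 := by rw [hs_def, Real.sq_sqrt hu.le]
  rw [hd, hdR, hu']
  field_simp
  ring

/-- Euclidean speed along the loop: `|γ′| = (κ/(2cu))·|∇Ψ|`. [cite: LeeCerfon2015, §4.1 (boundary parametrisation)] -/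
theorem speed_lcLoop {R₀ κ FB q₀ r : ℝ} (hR₀ : 0 < R₀) (hκ : 0 < κ) (hFB : 0 < FB) (hq₀ : 0 < q₀)
    (hr : 0 ≤ r) (h2r : 2 * r < R₀) (a t : ℝ) :
    speed (lcLoop R₀ κ r) t
      = κ / (2 * (κ * FB / (2 * R₀ ^ 3 * q₀)) * lcU R₀ r t)
          * Real.sqrt (gradSq (psiLC κ FB R₀ q₀ a) (lcLoop R₀ κ r t).1 (lcLoop R₀ κ r t).2) := by
  have hu := lcU_pos hR₀ hr h2r t
  have hl : 0 ≤ κ / (2 * (κ * FB / (2 * R₀ ^ 3 * q₀)) * lcU R₀ r t) := by positivity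
  unfold speed gradSq
  rw [deriv_lcLoop_fst hR₀ hκ hFB hq₀ hr h2r a t, deriv_lcLoop_snd hR₀ hκ hFB hq₀ hr h2r a t]
  rw [show ∀ (l P Q : ℝ), (-(l * Q)) ^ 2 + (l * P) ^ 2 = l ^ 2 * (P ^ 2 + Q ^ 2) from
    fun l P Q => by ring, Real.sqrt_mul (sq_nonneg _), Real.sqrt_sq hl]

/-- Poloidal field along the loop: `B_p = |∇Ψ|/R`, `R = √u`. [cite: Freidberg2014, §12.3 eq. (12.32)] -/
theorem fieldBpol_lcLoop {R₀ κ r : ℝ} (hR₀ : 0 < R₀) (hr : 0 ≤ r) (h2r : 2 * r < R₀)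
    (FB q₀ a t : ℝ) :
    fieldBpol (psiLC κ FB R₀ q₀ a) (lcLoop R₀ κ r t).1 (lcLoop R₀ κ r t).2
      = Real.sqrt (gradSq (psiLC κ FB R₀ q₀ a) (lcLoop R₀ κ r t).1 (lcLoop R₀ κ r t).2)
          / Real.sqrt (lcU R₀ r t) := by
  have hu := lcU_pos hR₀ hr h2r t
  have hs : 0 < Real.sqrt (lcU R₀ r t) := Real.sqrt_pos.2 hu
  have h1 : (lcLoop R₀ κ r t).1 = Real.sqrt (lcU R₀ r t) := rfl
  unfold fieldBpol fieldBR fieldBZ gradSq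
  rw [h1]
  rw [show ∀ (s P Q : ℝ), (-(s⁻¹ * Q)) ^ 2 + (s⁻¹ * P) ^ 2 = (P ^ 2 + Q ^ 2) / s ^ 2 from
    fun s P Q => by ring, Real.sqrt_div (by positivity), Real.sqrt_sq hs.le]

/-! ## Mercier's `I(U)` (12.84) on the printed loop as a one-dimensional integral -/

/-- Pointwise: the `I(U)` integrand `U/(R²B_p³)·|γ′|` along the loop is `U(γ(t))·w(t)` with the explicit weight
`w = lcMercierWeight` (`= κ√u/(2cu|∇Ψ|²)`). [cite: Freidberg2014, §12.5.3 eq. (12.84)] -/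
theorem lcLoop_mercierIntegrand {R₀ κ FB q₀ r : ℝ} (hR₀ : 0 < R₀) (hκ : 0 < κ) (hFB : 0 < FB)
    (hq₀ : 0 < q₀) (hr : 0 < r) (h2r : 2 * r < R₀) (a : ℝ) (U : ℝ → ℝ → ℝ) (t : ℝ) :
    U (lcLoop R₀ κ r t).1 (lcLoop R₀ κ r t).2
        / ((lcLoop R₀ κ r t).1 ^ 2 * fieldBpol (psiLC κ FB R₀ q₀ a) (lcLoop R₀ κ r t).1 (lcLoop R₀ κ r t).2 ^ 3)
        * speed (lcLoop R₀ κ r) t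
      = U (lcLoop R₀ κ r t).1 (lcLoop R₀ κ r t).2 * lcMercierWeight κ FB R₀ q₀ r t := by
  have hu := lcU_pos hR₀ hr.le h2r t
  have hs : 0 < Real.sqrt (lcU R₀ r t) := Real.sqrt_pos.2 hu
  have hs2 : Real.sqrt (lcU R₀ r t) ^ 2 = lcU R₀ r t := Real.sq_sqrt hu.le
  have hN := lcGradSq_pos hR₀ hκ hFB hq₀ hr h2r t
  have hNs : 0 < Real.sqrt (lcGradSq κ FB R₀ q₀ r t) := Real.sqrt_pos.2 hN
  have hNs2 : Real.sqrt (lcGradSq κ FB R₀ q₀ r t) ^ 2 = lcGradSq κ FB R₀ q₀ r t := Real.sq_sqrt hN.le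
  have h1 : (lcLoop R₀ κ r t).1 = Real.sqrt (lcU R₀ r t) := rfl
  rw [speed_lcLoop hR₀ hκ hFB hq₀ hr.le h2r a t, fieldBpol_lcLoop hR₀ hr.le h2r,
    gradSq_psiLC_lcLoop hR₀ hκ.ne' hr.le h2r, h1]
  unfold lcMercierWeight
  have hc : 0 < κ * FB / (2 * R₀ ^ 3 * q₀) := by positivity
  rw [div_pow, show Real.sqrt (lcGradSq κ FB R₀ q₀ r t) ^ 3
      = lcGradSq κ FB R₀ q₀ r t * Real.sqrt (lcGradSq κ FB R₀ q₀ r t) by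
        rw [pow_succ, hNs2],
    show Real.sqrt (lcU R₀ r t) ^ 3 = lcU R₀ r t * Real.sqrt (lcU R₀ r t) by rw [pow_succ, hs2]]
  field_simp
  rw [hs2]

/-- **Mercier's flux-surface functional (12.84), Euclidean arc length, on the printed Lee–Cerfon loop is the
one-dimensional integral `I(U) = (1/2π) ∫₀^{2π} U(γ(t))·w(t) dt`** with the explicit algebraic weight
`w = lcMercierWeight κ F_B R₀ q₀ r` — for ANY integrand `U` (`U ∈ {1, B², RB_pκ_n, Γ, Γ/B²}` in (12.84)),
every surface `0 < r < R₀/2`, `κ, F_B, q₀ > 0`. [cite: Freidberg2014, §12.5.3 eq. (12.84)] -/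
theorem mercierIE_lcLoop {R₀ κ FB q₀ r : ℝ} (hR₀ : 0 < R₀) (hκ : 0 < κ) (hFB : 0 < FB) (hq₀ : 0 < q₀)
    (hr : 0 < r) (h2r : 2 * r < R₀) (a : ℝ) (U : ℝ → ℝ → ℝ) :
    mercierIE (psiLC κ FB R₀ q₀ a) (lcLoop R₀ κ r) (2 * π) U
      = 1 / (2 * π) * ∫ t in (0 : ℝ)..(2 * π),
          U (lcLoop R₀ κ r t).1 (lcLoop R₀ κ r t).2 * lcMercierWeight κ FB R₀ q₀ r t := by
  unfold mercierIE loopIntegralE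
  congr 1
  exact intervalIntegral.integral_congr fun t _ => lcLoop_mercierIntegrand hR₀ hκ hFB hq₀ hr h2r a U t

/-- In particular `I(1) = (1/2π)∫₀^{2π} w(t) dt`. [cite: Freidberg2014, §12.5.3 eq. (12.84)] -/
theorem mercierIE_lcLoop_one {R₀ κ FB q₀ r : ℝ} (hR₀ : 0 < R₀) (hκ : 0 < κ) (hFB : 0 < FB) (hq₀ : 0 < q₀)
    (hr : 0 < r) (h2r : 2 * r < R₀) (a : ℝ) :
    mercierIE (psiLC κ FB R₀ q₀ a) (lcLoop R₀ κ r) (2 * π) (fun _ _ => 1)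
      = 1 / (2 * π) * ∫ t in (0 : ℝ)..(2 * π), lcMercierWeight κ FB R₀ q₀ r t := by
  rw [mercierIE_lcLoop hR₀ hκ hFB hq₀ hr h2r a]
  simp only [one_mul]

end Literature.MathematicalPhysics.MHD.Solovev
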